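import Literature.NumberTheory.Rogawski1990.ArchCompactWallTransversalExpansion   -- ★ p842550 (A2′) (this seat): derivatives under ∫ along lines, conjugated curves, `N²Φ|_{wall}` along every conjugate of the normal curve
import Mathlib.MeasureTheory.Integral.Prod
import HarnessLib

/-!
# ROAD A (A2″) part 1 — THE COMPACT CENTRALISER OF A COMPACT-WALL POINT, AND THE `Z(t₀)`-AVERAGE OF THE TRANSVERSAL SECOND DERIVATIVE: a class function on the
# singular orbit `G_w·t₀` whose Haar integral is `N²Φ|_{wall}` (Rogawski 1990 §8.2 pp. 122–123, §8.4 p. 126; the input shape of the hat-box chart (A3))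

Topic `NumberTheory/Automorphic`; namespace `Literature.NumberTheory.Automorphic.UnitaryGroup`.  THEOREMS ONLY (no `def`, no instance, no notation, no axiom, no named fact, no
`sorry`).  Cell `pub/hodgecm-mathlib`, ENGINE T1 (crux H413 = `stmt-HodgeConjecture-24833`); ROAD A toward the (L_{U(2,1)}) letter N1 (price of record = A-p14 (g28) census
dd43a5a7, chair F0P3a-plan (g10) T9-3 (3)); brick **(A2″) part 1 (chart-free)**, sequel of ★ (A2′) p842550; author A-p14 (g28).

THE MATHEMATICS.  `G_w = archLocal L N (diagonal α) w`, `t₀ = diag ζ` a wall point block-separated for a constant-sign labelling `b` (coincidences inside blocks only), `M := Z_{G_w}(t₀)`.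
* §1 **`M` IS COMPACT**: it is `{g | g t₀ g⁻¹ = t₀}`, a fibre of the proper conjugation map (★ (C-cw) `isCompact_setOf_exists_conj_circleDiagonal_mem_of_blocks` at `K = {ζ}`, `C = {t₀}`).
* §2 **THE `M`-AVERAGE**: ★ (A2′) gives, for EVERY `u ∈ G_w`, `N²Φ_Θ(t₀) = ∫_{G_w} F(u, g) dν(g)`, `F(u,g) := ∂²_y|₀ Θ(↑↑(g·(u t_y u⁻¹)·g⁻¹))` (`t_y` the normal torus curve through
  `t₀`).  Hence for every FINITE measure `μ` on `M`: `μ(M) · N²Φ_Θ(t₀) = ∫_M ∫_{G_w} F(m,g) dν dμ = ∫_{G_w} Ψ_μ(g) dν`, `Ψ_μ(g) := ∫_M F(m, g) dμ(m)` (Fubini: `F` is jointly continuous —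
  ★ Hörmander `continuous_iteratedFDeriv_comp_affine_param` — and vanishes unless `g m` lies in the uniform support compact `S` of ★ (C-cw), i.e. off the compact `S·M`).
* §3 **`Ψ_μ` IS A CLASS FUNCTION ON THE SINGULAR ORBIT** when `μ` is left-invariant on `M`: `Ψ_μ(g m′) = Ψ_μ(g)` (`F(m, g m′) = F(m′m, g)` and `∫ F(m′m, g) dμ = ∫ F(m, g) dμ`) — so
  `N²Φ_Θ(t₀) = μ(M)⁻¹ ∫_{G_w} Ψ_μ dν` with `Ψ_μ` descending to `G_w∕M ≅ G_w·t₀`; at `N = 3`, `U(2,1)`, `t₀ = k_v`, this is the ball `H²_ℂ` of ★ (A3-a) `integral_comp_conj_kCentral_eq_integral_map_orbit`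
  and (A2″) part 2 computes `Ψ_μ(P) = μ(M)·[(u²∕3) tr_{𝔰_P} D²Θ(h) − u·DΘ(h)[1 − P]]` in the pencil chart.
HONEST LABEL: HC_CM is proved only modulo the printed citations until rung 0 closes; measure-theoretic bookkeeping, pays nothing by itself.

## References
* [Rogawski1990] J. D. Rogawski, *Automorphic Representations of Unitary Groups in Three Variables*, Ann. of Math. Stud. 123 (1990), §8.2 pp. 122–123, §8.4 p. 126.
* [DeitmarEchterhoff2014] A. Deitmar, S. Echterhoff, *Principles of Harmonic Analysis*, 2nd ed. (2014), Lemma 9.3.3 (properness of conjugation), Thm. 1.5.3.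
* [HormanderALPDO1] L. Hörmander, *The Analysis of Linear Partial Differential Operators I*, Thm. 1.1.9.
-/

set_option autoImplicit false

noncomputable section

open MeasureTheory Measure Filter Topology Set Function Metric NumberField NumberField.InfinitePlace
open scoped ContDiff

namespace Literature.NumberTheory.Automorphic.UnitaryGroup

open Literature.Analysis.Calculus
open scoped Matrix MatrixGroups
open scoped Matrix.Norms.Operator

section Centralizer

variable (L : Type) [Field L] (N : ℕ) (α : Fin N → L) (w : {w : InfinitePlace L // IsComplex w})

/-- **THE CENTRALISER OF A COMPACT-WALL TORUS POINT IS COMPACT**: for `ζ` block-separated with respect to a constant-sign labelling `b` (coincidences `ζ_i = ζ_j` allowed only when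
`e_i e_j > 0`), `Z_{G_w}(diag ζ)` is compact — it is the fibre `{g | g·diag ζ·g⁻¹ = diag ζ}` of the proper conjugation map (★ `isCompact_setOf_exists_conj_circleDiagonal_mem_of_blocks` at
`K = {ζ}`, `C = {diag ζ}`).  (At `N = 3`, `U(2,1)`, `ζ = (u,u,v)`: `Z = U(2) × U(1)`.) [cite: Rogawski1990, §8.2 pp. 122–123] [cite: DeitmarEchterhoff2014, Lemma 9.3.3] -/
theorem compactSpace_centralizer_circleDiagonal_of_blocks (hα : ∀ i, α i ≠ 0) (hreal : ∀ i, (w.1.embedding (α i)).im = 0)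
    {ι : Type*} (b : Fin N → ι) (hsign : ∀ i j, i ≠ j → b i = b j → 0 < (w.1.embedding (α i)).re * (w.1.embedding (α j)).re)
    (ζ : Fin N → Circle) (hζ : ∀ k l, b k ≠ b l → ζ k ≠ ζ l) :
    CompactSpace ↥(Subgroup.centralizer ({(⟨circleDiagonal N ζ, circleDiagonal_mem_archLocal_diagonal L N α w ζ⟩ : archLocal L N (Matrix.diagonal α) w)} :
      Set (archLocal L N (Matrix.diagonal α) w))) := by
  set t₀ : archLocal L N (Matrix.diagonal α) w := ⟨circleDiagonal N ζ, circleDiagonal_mem_archLocal_diagonal L N α w ζ⟩ with ht₀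
  have hK : IsCompact ({ζ} : Set (Fin N → Circle)) := isCompact_singleton
  have hKsep : ({ζ} : Set (Fin N → Circle)) ⊆ {z | ∀ i j, b i ≠ b j → z i ≠ z j} := by
    rintro z (rfl : z = ζ); exact hζ
  have hC : IsCompact ({t₀} : Set (archLocal L N (Matrix.diagonal α) w)) := isCompact_singleton
  have h := isCompact_setOf_exists_conj_circleDiagonal_mem_of_blocks L N α w hα hreal b hsign hK hKsep hC
  have hset : {g : archLocal L N (Matrix.diagonal α) w | ∃ z ∈ ({ζ} : Set (Fin N → Circle)),
      g * ⟨circleDiagonal N z, circleDiagonal_mem_archLocal_diagonal L N α w z⟩ * g⁻¹ ∈ ({t₀} : Set (archLocal L N (Matrix.diagonal α) w))} =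
      (Subgroup.centralizer ({t₀} : Set (archLocal L N (Matrix.diagonal α) w)) : Set (archLocal L N (Matrix.diagonal α) w)) := by
    ext g
    simp only [Set.mem_setOf_eq, Set.mem_singleton_iff, exists_eq_left, SetLike.mem_coe, Subgroup.mem_centralizer_singleton_iff]
    rw [← ht₀]
    constructor
    · intro hg
      have := congrArg (· * g) hg
      simpa only [inv_mul_cancel_right] using this
    · intro hg
      rw [hg, mul_inv_cancel_right]
  rw [hset] at h
  exact isCompact_iff_compactSpace.mp h

end Centralizer

/-! ## §2 The `Z(t₀)`-average of the transversal second derivative -/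

section Average

variable (L : Type) [Field L] (N : ℕ) (α : Fin N → L) (w : {w : InfinitePlace L // IsComplex w})
  {E : Type*} [NormedAddCommGroup E] [NormedSpace ℝ E] [CompleteSpace E]
  [MeasurableSpace (archLocal L N (Matrix.diagonal α) w)] [BorelSpace (archLocal L N (Matrix.diagonal α) w)]

/-- **`μ(M)·N²Φ|_{wall}` AS A DOUBLE INTEGRAL**: for every finite measure `μ` on the centraliser `M = Z(t₀)` of a compact-wall point,
`μ(univ) • ∂²_y|₀ ∫ Θ(g·t_y·g⁻¹) dν = ∫_M ∫_{G_w} ∂²_y|₀ Θ(↑↑(g·(m t_y m⁻¹)·g⁻¹)) dν dμ(m)` — ★ (A2′) `iteratedDeriv_two_integral_comp_conj_circleDiagonal_wallLine_eq_integral_conj` for every `m`, then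
`∫_M const dμ`. [cite: Rogawski1990, §8.2 pp. 122–123; §8.4 p. 126] -/
theorem smul_iteratedDeriv_two_integral_wallLine_eq_integral_integral (hα : ∀ i, α i ≠ 0) (hreal : ∀ i, (w.1.embedding (α i)).im = 0)
    {ι : Type*} (b : Fin N → ι) (hsign : ∀ i j, i ≠ j → b i = b j → 0 < (w.1.embedding (α i)).re * (w.1.embedding (α j)).re)
    (ν : Measure (archLocal L N (Matrix.diagonal α) w)) [IsFiniteMeasureOnCompacts ν] [ν.IsMulRightInvariant]
    (Θ : Matrix (Fin N) (Fin N) ℂ → E) (hΘ : ContDiff ℝ ∞ Θ) (hfc : HasCompactSupport fun k : archLocal L N (Matrix.diagonal α) w => Θ (((k : GL (Fin N) ℂ) : Matrix (Fin N) (Fin N) ℂ)))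
    (ζ : Fin N → Circle) (hζ : ∀ k l, b k ≠ b l → ζ k ≠ ζ l) (i j : Fin N)
    [MeasurableSpace ↥(Subgroup.centralizer ({(⟨circleDiagonal N ζ, circleDiagonal_mem_archLocal_diagonal L N α w ζ⟩ : archLocal L N (Matrix.diagonal α) w)} :
      Set (archLocal L N (Matrix.diagonal α) w)))]
    (μ : Measure ↥(Subgroup.centralizer ({(⟨circleDiagonal N ζ, circleDiagonal_mem_archLocal_diagonal L N α w ζ⟩ : archLocal L N (Matrix.diagonal α) w)} :
      Set (archLocal L N (Matrix.diagonal α) w)))) [IsFiniteMeasure μ] :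
    (μ Set.univ).toReal • iteratedDeriv 2 (fun y : ℝ => ∫ g : archLocal L N (Matrix.diagonal α) w,
        Θ ((((g * ⟨circleDiagonal N fun k => ζ k * Circle.exp (y * ((if k = i then 1 else 0) - (if k = j then 1 else 0))),
          circleDiagonal_mem_archLocal_diagonal L N α w _⟩ * g⁻¹ : archLocal L N (Matrix.diagonal α) w) : GL (Fin N) ℂ) : Matrix (Fin N) (Fin N) ℂ)) ∂ν) 0 =
      ∫ m, ∫ g : archLocal L N (Matrix.diagonal α) w, iteratedDeriv 2 (fun y : ℝ =>
        Θ ((((g * ((m : archLocal L N (Matrix.diagonal α) w) * ⟨circleDiagonal N fun k => ζ k * Circle.exp (y * ((if k = i then 1 else 0) - (if k = j then 1 else 0))),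
          circleDiagonal_mem_archLocal_diagonal L N α w _⟩ * (m : archLocal L N (Matrix.diagonal α) w)⁻¹) * g⁻¹ : archLocal L N (Matrix.diagonal α) w) : GL (Fin N) ℂ) :
            Matrix (Fin N) (Fin N) ℂ))) 0 ∂ν ∂μ := by
  have h : ∀ m : ↥(Subgroup.centralizer ({(⟨circleDiagonal N ζ, circleDiagonal_mem_archLocal_diagonal L N α w ζ⟩ : archLocal L N (Matrix.diagonal α) w)} :
      Set (archLocal L N (Matrix.diagonal α) w))),
      ∫ g : archLocal L N (Matrix.diagonal α) w, iteratedDeriv 2 (fun y : ℝ =>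
        Θ ((((g * ((m : archLocal L N (Matrix.diagonal α) w) * ⟨circleDiagonal N fun k => ζ k * Circle.exp (y * ((if k = i then 1 else 0) - (if k = j then 1 else 0))),
          circleDiagonal_mem_archLocal_diagonal L N α w _⟩ * (m : archLocal L N (Matrix.diagonal α) w)⁻¹) * g⁻¹ : archLocal L N (Matrix.diagonal α) w) : GL (Fin N) ℂ) :
            Matrix (Fin N) (Fin N) ℂ))) 0 ∂ν =
      iteratedDeriv 2 (fun y : ℝ => ∫ g : archLocal L N (Matrix.diagonal α) w,
        Θ ((((g * ⟨circleDiagonal N fun k => ζ k * Circle.exp (y * ((if k = i then 1 else 0) - (if k = j then 1 else 0))),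
          circleDiagonal_mem_archLocal_diagonal L N α w _⟩ * g⁻¹ : archLocal L N (Matrix.diagonal α) w) : GL (Fin N) ℂ) : Matrix (Fin N) (Fin N) ℂ)) ∂ν) 0 := fun m =>
    (iteratedDeriv_two_integral_comp_conj_circleDiagonal_wallLine_eq_integral_conj L N α w hα hreal b hsign ν Θ hΘ hfc ζ hζ i j (m : archLocal L N (Matrix.diagonal α) w)).symm
  rw [show (fun m : ↥(Subgroup.centralizer ({(⟨circleDiagonal N ζ, circleDiagonal_mem_archLocal_diagonal L N α w ζ⟩ : archLocal L N (Matrix.diagonal α) w)} :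
      Set (archLocal L N (Matrix.diagonal α) w))) => ∫ g : archLocal L N (Matrix.diagonal α) w, iteratedDeriv 2 (fun y : ℝ =>
        Θ ((((g * ((m : archLocal L N (Matrix.diagonal α) w) * ⟨circleDiagonal N fun k => ζ k * Circle.exp (y * ((if k = i then 1 else 0) - (if k = j then 1 else 0))),
          circleDiagonal_mem_archLocal_diagonal L N α w _⟩ * (m : archLocal L N (Matrix.diagonal α) w)⁻¹) * g⁻¹ : archLocal L N (Matrix.diagonal α) w) : GL (Fin N) ℂ) :
            Matrix (Fin N) (Fin N) ℂ))) 0 ∂ν) = fun _ => iteratedDeriv 2 (fun y : ℝ => ∫ g : archLocal L N (Matrix.diagonal α) w,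
        Θ ((((g * ⟨circleDiagonal N fun k => ζ k * Circle.exp (y * ((if k = i then 1 else 0) - (if k = j then 1 else 0))),
          circleDiagonal_mem_archLocal_diagonal L N α w _⟩ * g⁻¹ : archLocal L N (Matrix.diagonal α) w) : GL (Fin N) ℂ) : Matrix (Fin N) (Fin N) ℂ)) ∂ν) 0 from funext h]
  rw [integral_const, measureReal_def]

omit [CompleteSpace E] [MeasurableSpace (archLocal L N (Matrix.diagonal α) w)] [BorelSpace (archLocal L N (Matrix.diagonal α) w)] in
/-- **THE `M`-AVERAGED INTEGRAND IS INVARIANT UNDER RIGHT TRANSLATION BY `M`** (`μ` left-invariant on `M = Z(t₀)`): with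
`Ψ_μ(g) := ∫_M ∂²_y|₀ Θ(↑↑(g·(m t_y m⁻¹)·g⁻¹)) dμ(m)`, `Ψ_μ(g·m′) = Ψ_μ(g)` — `Ψ_μ` is a function on the singular orbit `G_w∕M ≅ G_w·t₀` (the ball `H²_ℂ` at a `U(2,1)` place).
[cite: Rogawski1990, §8.2 pp. 122–123] [cite: DeitmarEchterhoff2014, Thm. 1.5.3] -/
theorem integral_iteratedDeriv_two_comp_conj_mul_centralizer_eq
    (Θ : Matrix (Fin N) (Fin N) ℂ → E) (ζ : Fin N → Circle) (i j : Fin N)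
    [MeasurableSpace ↥(Subgroup.centralizer ({(⟨circleDiagonal N ζ, circleDiagonal_mem_archLocal_diagonal L N α w ζ⟩ : archLocal L N (Matrix.diagonal α) w)} :
      Set (archLocal L N (Matrix.diagonal α) w)))]
    [MeasurableMul ↥(Subgroup.centralizer ({(⟨circleDiagonal N ζ, circleDiagonal_mem_archLocal_diagonal L N α w ζ⟩ : archLocal L N (Matrix.diagonal α) w)} :
      Set (archLocal L N (Matrix.diagonal α) w)))]
    (μ : Measure ↥(Subgroup.centralizer ({(⟨circleDiagonal N ζ, circleDiagonal_mem_archLocal_diagonal L N α w ζ⟩ : archLocal L N (Matrix.diagonal α) w)} :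
      Set (archLocal L N (Matrix.diagonal α) w)))) [μ.IsMulLeftInvariant]
    (g : archLocal L N (Matrix.diagonal α) w)
    (m' : ↥(Subgroup.centralizer ({(⟨circleDiagonal N ζ, circleDiagonal_mem_archLocal_diagonal L N α w ζ⟩ : archLocal L N (Matrix.diagonal α) w)} :
      Set (archLocal L N (Matrix.diagonal α) w)))) :
    ∫ m, iteratedDeriv 2 (fun y : ℝ =>
        Θ (((((g * (m' : archLocal L N (Matrix.diagonal α) w)) * ((m : archLocal L N (Matrix.diagonal α) w) *
          ⟨circleDiagonal N fun k => ζ k * Circle.exp (y * ((if k = i then 1 else 0) - (if k = j then 1 else 0))),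
            circleDiagonal_mem_archLocal_diagonal L N α w _⟩ * (m : archLocal L N (Matrix.diagonal α) w)⁻¹) * (g * (m' : archLocal L N (Matrix.diagonal α) w))⁻¹ :
              archLocal L N (Matrix.diagonal α) w) : GL (Fin N) ℂ) : Matrix (Fin N) (Fin N) ℂ))) 0 ∂μ =
      ∫ m, iteratedDeriv 2 (fun y : ℝ =>
        Θ ((((g * ((m : archLocal L N (Matrix.diagonal α) w) *
          ⟨circleDiagonal N fun k => ζ k * Circle.exp (y * ((if k = i then 1 else 0) - (if k = j then 1 else 0))),
            circleDiagonal_mem_archLocal_diagonal L N α w _⟩ * (m : archLocal L N (Matrix.diagonal α) w)⁻¹) * g⁻¹ :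
              archLocal L N (Matrix.diagonal α) w) : GL (Fin N) ℂ) : Matrix (Fin N) (Fin N) ℂ))) 0 ∂μ := by
  -- `(g m′)·(m t m⁻¹)·(g m′)⁻¹ = g·((m′m) t (m′m)⁻¹)·g⁻¹`, then left-invariance `m ↦ m′ m`
  have hpt : ∀ (m : ↥(Subgroup.centralizer ({(⟨circleDiagonal N ζ, circleDiagonal_mem_archLocal_diagonal L N α w ζ⟩ : archLocal L N (Matrix.diagonal α) w)} :
      Set (archLocal L N (Matrix.diagonal α) w)))) (t : archLocal L N (Matrix.diagonal α) w),
      (g * (m' : archLocal L N (Matrix.diagonal α) w)) * ((m : archLocal L N (Matrix.diagonal α) w) * t * (m : archLocal L N (Matrix.diagonal α) w)⁻¹) *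
          (g * (m' : archLocal L N (Matrix.diagonal α) w))⁻¹ =
        g * (((m' * m : ↥(Subgroup.centralizer ({(⟨circleDiagonal N ζ, circleDiagonal_mem_archLocal_diagonal L N α w ζ⟩ : archLocal L N (Matrix.diagonal α) w)} : Set (archLocal L N (Matrix.diagonal α) w)))) : archLocal L N (Matrix.diagonal α) w) * t *
          ((m' * m : ↥(Subgroup.centralizer ({(⟨circleDiagonal N ζ, circleDiagonal_mem_archLocal_diagonal L N α w ζ⟩ : archLocal L N (Matrix.diagonal α) w)} : Set (archLocal L N (Matrix.diagonal α) w)))) : archLocal L N (Matrix.diagonal α) w)⁻¹) * g⁻¹ := by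
    intro m t
    rw [Subgroup.coe_mul]
    simp only [_root_.mul_inv_rev, mul_assoc]
  -- name the unconjugated integrand `B`
  obtain ⟨B, hB⟩ : ∃ B : ↥(Subgroup.centralizer ({(⟨circleDiagonal N ζ, circleDiagonal_mem_archLocal_diagonal L N α w ζ⟩ : archLocal L N (Matrix.diagonal α) w)} : Set (archLocal L N (Matrix.diagonal α) w))) → E, B = fun m : ↥(Subgroup.centralizer ({(⟨circleDiagonal N ζ, circleDiagonal_mem_archLocal_diagonal L N α w ζ⟩ : archLocal L N (Matrix.diagonal α) w)} : Set (archLocal L N (Matrix.diagonal α) w))) => iteratedDeriv 2 (fun y : ℝ =>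
      Θ ((((g * ((m : archLocal L N (Matrix.diagonal α) w) * ⟨circleDiagonal N fun k => ζ k * Circle.exp (y * ((if k = i then 1 else 0) - (if k = j then 1 else 0))), circleDiagonal_mem_archLocal_diagonal L N α w _⟩ * (m : archLocal L N (Matrix.diagonal α) w)⁻¹) * g⁻¹ : archLocal L N (Matrix.diagonal α) w) : GL (Fin N) ℂ) : Matrix (Fin N) (Fin N) ℂ))) 0 := ⟨_, rfl⟩
  have key : ∀ m : ↥(Subgroup.centralizer ({(⟨circleDiagonal N ζ, circleDiagonal_mem_archLocal_diagonal L N α w ζ⟩ : archLocal L N (Matrix.diagonal α) w)} : Set (archLocal L N (Matrix.diagonal α) w))), iteratedDeriv 2 (fun y : ℝ =>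
      Θ (((((g * (m' : archLocal L N (Matrix.diagonal α) w)) * ((m : archLocal L N (Matrix.diagonal α) w) * ⟨circleDiagonal N fun k => ζ k * Circle.exp (y * ((if k = i then 1 else 0) - (if k = j then 1 else 0))), circleDiagonal_mem_archLocal_diagonal L N α w _⟩ * (m : archLocal L N (Matrix.diagonal α) w)⁻¹) * (g * (m' : archLocal L N (Matrix.diagonal α) w))⁻¹ : archLocal L N (Matrix.diagonal α) w) : GL (Fin N) ℂ) : Matrix (Fin N) (Fin N) ℂ))) 0 =
        B (m' * m) := by
    intro m
    rw [hB]
    show iteratedDeriv 2 _ 0 = iteratedDeriv 2 _ 0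
    congr 1
    funext y
    rw [hpt]
  rw [integral_congr_ae (Eventually.of_forall key), integral_mul_left_eq_self B m', hB]

end Average

/-! ## §4 (ED. 2, A-p14 (g28) 2026-09-01) Fubini: `μ(M)·N²Φ|_{wall} = ∫_{G_w} Ψ_μ dν` — the double integral of §2 swapped, so the `M`-average class function of §3 integrates to `μ(M)·N²Φ` -/

section Fubini

variable (L : Type) [Field L] (N : ℕ) (α : Fin N → L) (w : {w : InfinitePlace L // IsComplex w})
  {E : Type*} [NormedAddCommGroup E] [NormedSpace ℝ E] [CompleteSpace E]
  [MeasurableSpace (archLocal L N (Matrix.diagonal α) w)] [BorelSpace (archLocal L N (Matrix.diagonal α) w)]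

omit [CompleteSpace E] in
/-- **THE TRANSVERSAL SECOND DERIVATIVE, JOINTLY IN `(m, g)`, IS CONTINUOUS WITH SUPPORT IN `M × (S·M⁻¹)`, HENCE FUBINI APPLIES**: for a compact-wall point `t₀ = diag ζ`, every finite
measure `μ` on `M = Z(t₀)` and every s-finite `ν` finite on compacts,
`∫_M ∫_{G_w} ∂²_y|₀ Θ(↑↑(g·(m t_y m⁻¹)·g⁻¹)) dν dμ = ∫_{G_w} ∫_M ∂²_y|₀ Θ(↑↑(g·(m t_y m⁻¹)·g⁻¹)) dμ dν` — so with §2: `μ(M)·N²Φ_Θ(t₀) = ∫_{G_w} Ψ_μ(g) dν(g)`,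
`Ψ_μ` the class function of §3 (joint continuity: ★ Hörmander `continuous_iteratedFDeriv_comp_affine_param`; support: off the compact `S·M⁻¹`, `S` the uniform support of ★ (C-cw),
the `y`-germ vanishes). [cite: Rogawski1990, §8.2 pp. 122–123; §8.4 p. 126] [cite: DeitmarEchterhoff2014, Thm. 1.5.3] [cite: HormanderALPDO1, Thm. 1.1.9] -/
theorem integral_integral_iteratedDeriv_two_comp_conj_centralizer_swap (hα : ∀ i, α i ≠ 0) (hreal : ∀ i, (w.1.embedding (α i)).im = 0)
    {ι : Type*} (b : Fin N → ι) (hsign : ∀ i j, i ≠ j → b i = b j → 0 < (w.1.embedding (α i)).re * (w.1.embedding (α j)).re)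
    (ν : Measure (archLocal L N (Matrix.diagonal α) w)) [IsFiniteMeasureOnCompacts ν] [SFinite ν]
    (Θ : Matrix (Fin N) (Fin N) ℂ → E) (hΘ : ContDiff ℝ ∞ Θ) (hfc : HasCompactSupport fun k : archLocal L N (Matrix.diagonal α) w => Θ (((k : GL (Fin N) ℂ) : Matrix (Fin N) (Fin N) ℂ)))
    (ζ : Fin N → Circle) (hζ : ∀ k l, b k ≠ b l → ζ k ≠ ζ l) (i j : Fin N)
    [SecondCountableTopology (archLocal L N (Matrix.diagonal α) w)]
    [MeasurableSpace ↥(Subgroup.centralizer ({(⟨circleDiagonal N ζ, circleDiagonal_mem_archLocal_diagonal L N α w ζ⟩ : archLocal L N (Matrix.diagonal α) w)} : Set (archLocal L N (Matrix.diagonal α) w)))] [BorelSpace ↥(Subgroup.centralizer ({(⟨circleDiagonal N ζ, circleDiagonal_mem_archLocal_diagonal L N α w ζ⟩ : archLocal L N (Matrix.diagonal α) w)} : Set (archLocal L N (Matrix.diagonal α) w)))] (μ : Measure ↥(Subgroup.centralizer ({(⟨circleDiagonal N ζ, circleDiagonal_mem_archLocal_diagonal L N α w ζ⟩ : archLocal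 L N (Matrix.diagonal α) w)} : Set (archLocal L N (Matrix.diagonal α) w)))) [IsFiniteMeasure μ] :
    ∫ m, ∫ g : archLocal L N (Matrix.diagonal α) w, iteratedDeriv 2 (fun y : ℝ =>
        Θ ((((g * ((m : archLocal L N (Matrix.diagonal α) w) * ⟨circleDiagonal N fun k => ζ k * Circle.exp (y * ((if k = i then 1 else 0) - (if k = j then 1 else 0))), circleDiagonal_mem_archLocal_diagonal L N α w _⟩ * (m : archLocal L N (Matrix.diagonal α) w)⁻¹) * g⁻¹ : archLocal L N (Matrix.diagonal α) w) : GL (Fin N) ℂ) : Matrix (Fin N) (Fin N) ℂ))) 0 ∂ν ∂μ =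
      ∫ g : archLocal L N (Matrix.diagonal α) w, ∫ m, iteratedDeriv 2 (fun y : ℝ =>
        Θ ((((g * ((m : archLocal L N (Matrix.diagonal α) w) * ⟨circleDiagonal N fun k => ζ k * Circle.exp (y * ((if k = i then 1 else 0) - (if k = j then 1 else 0))), circleDiagonal_mem_archLocal_diagonal L N α w _⟩ * (m : archLocal L N (Matrix.diagonal α) w)⁻¹) * g⁻¹ : archLocal L N (Matrix.diagonal α) w) : GL (Fin N) ℂ) : Matrix (Fin N) (Fin N) ℂ))) 0 ∂μ ∂ν := by
  haveI : CompactSpace ↥(Subgroup.centralizer ({(⟨circleDiagonal N ζ, circleDiagonal_mem_archLocal_diagonal L N α w ζ⟩ : archLocal L N (Matrix.diagonal α) w)} : Set (archLocal L N (Matrix.diagonal α) w))) := compactSpace_centralizer_circleDiagonal_of_blocks L N α w hα hreal b hsign ζ hζ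
  -- the integrand as a function on `M × G_w`
  obtain ⟨F, hF⟩ : ∃ F : ↥(Subgroup.centralizer ({(⟨circleDiagonal N ζ, circleDiagonal_mem_archLocal_diagonal L N α w ζ⟩ : archLocal L N (Matrix.diagonal α) w)} : Set (archLocal L N (Matrix.diagonal α) w))) × archLocal L N (Matrix.diagonal α) w → E, F = fun q => iteratedDeriv 2 (fun y : ℝ =>
      Θ ((((q.2 * ((q.1 : archLocal L N (Matrix.diagonal α) w) * ⟨circleDiagonal N fun k => ζ k * Circle.exp (y * ((if k = i then 1 else 0) - (if k = j then 1 else 0))), circleDiagonal_mem_archLocal_diagonal L N α w _⟩ * (q.1 : archLocal L N (Matrix.diagonal α) w)⁻¹) * q.2⁻¹ : archLocal L N (Matrix.diagonal α) w) : GL (Fin N) ℂ) : Matrix (Fin N) (Fin N) ℂ))) 0 := ⟨_, rfl⟩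
  -- the jointly smooth presentation `Ψ (L y + c q)`, `c q = ((q.2 q.1, (q.2 q.1)⁻¹), 0)`
  have hline : ContDiff ℝ ∞ fun y : ℝ => fun k : Fin N => y * ((if k = i then (1:ℝ) else 0) - (if k = j then 1 else 0)) :=
    contDiff_pi.2 fun k => contDiff_id.mul contDiff_const
  set Ψ : (Matrix (Fin N) (Fin N) ℂ × Matrix (Fin N) (Fin N) ℂ) × ℝ → E :=
    fun q => Θ (q.1.1 * ((circleDiagonal N fun k => ζ k * Circle.exp (q.2 * ((if k = i then (1:ℝ) else 0) - (if k = j then 1 else 0))) :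
      GL (Fin N) ℂ) : Matrix (Fin N) (Fin N) ℂ) * q.1.2) with hΨ
  have hΨd : ContDiff ℝ ∞ Ψ :=
    hΘ.comp (((contDiff_fst.comp contDiff_fst).mul (((contDiff_coe_circleDiagonal_angles N ζ).comp hline).comp contDiff_snd)).mul (contDiff_snd.comp contDiff_fst))
  set c : ↥(Subgroup.centralizer ({(⟨circleDiagonal N ζ, circleDiagonal_mem_archLocal_diagonal L N α w ζ⟩ : archLocal L N (Matrix.diagonal α) w)} : Set (archLocal L N (Matrix.diagonal α) w))) × archLocal L N (Matrix.diagonal α) w → (Matrix (Fin N) (Fin N) ℂ × Matrix (Fin N) (Fin N) ℂ) × ℝ :=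
    fun q => (((((q.2 * (q.1 : archLocal L N (Matrix.diagonal α) w) : archLocal L N (Matrix.diagonal α) w) : GL (Fin N) ℂ) : Matrix (Fin N) (Fin N) ℂ),
      ((((q.2 * (q.1 : archLocal L N (Matrix.diagonal α) w))⁻¹ : archLocal L N (Matrix.diagonal α) w) : GL (Fin N) ℂ) : Matrix (Fin N) (Fin N) ℂ)), (0 : ℝ)) with hc
  have hgm : Continuous fun q : ↥(Subgroup.centralizer ({(⟨circleDiagonal N ζ, circleDiagonal_mem_archLocal_diagonal L N α w ζ⟩ : archLocal L N (Matrix.diagonal α) w)} : Set (archLocal L N (Matrix.diagonal α) w))) × archLocal L N (Matrix.diagonal α) w => q.2 * (q.1 : archLocal L N (Matrix.diagonal α) w) := continuous_snd.mul (continuous_subtype_val.comp continuous_fst)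
  have hcc : Continuous c :=
    (((Units.continuous_val.comp continuous_subtype_val).comp hgm).prodMk
      (((Units.continuous_val.comp continuous_subtype_val).comp continuous_inv).comp hgm)).prodMk continuous_const
  set Lr : ℝ →L[ℝ] (Matrix (Fin N) (Fin N) ℂ × Matrix (Fin N) (Fin N) ℂ) × ℝ := ContinuousLinearMap.inr ℝ _ ℝ with hLr
  have hconj : ∀ (q : ↥(Subgroup.centralizer ({(⟨circleDiagonal N ζ, circleDiagonal_mem_archLocal_diagonal L N α w ζ⟩ : archLocal L N (Matrix.diagonal α) w)} : Set (archLocal L N (Matrix.diagonal α) w))) × archLocal L N (Matrix.diagonal α) w) (y : ℝ),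
      q.2 * ((q.1 : archLocal L N (Matrix.diagonal α) w) * ⟨circleDiagonal N fun k => ζ k * Circle.exp (y * ((if k = i then 1 else 0) - (if k = j then 1 else 0))), circleDiagonal_mem_archLocal_diagonal L N α w _⟩ * (q.1 : archLocal L N (Matrix.diagonal α) w)⁻¹) * q.2⁻¹ = (q.2 * (q.1 : archLocal L N (Matrix.diagonal α) w)) * ⟨circleDiagonal N fun k => ζ k * Circle.exp (y * ((if k = i then 1 else 0) - (if k = j then 1 else 0))), circleDiagonal_mem_archLocal_diagonal L N α w _⟩ * (q.2 * (q.1 : archLocal L N (Matrix.diagonal α) w))⁻¹ := fun q y => by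
    rw [_root_.mul_inv_rev]; simp only [mul_assoc]
  have hpres : ∀ q : ↥(Subgroup.centralizer ({(⟨circleDiagonal N ζ, circleDiagonal_mem_archLocal_diagonal L N α w ζ⟩ : archLocal L N (Matrix.diagonal α) w)} : Set (archLocal L N (Matrix.diagonal α) w))) × archLocal L N (Matrix.diagonal α) w, (fun y : ℝ => Ψ (Lr y + c q)) = fun y : ℝ =>
      Θ ((((q.2 * ((q.1 : archLocal L N (Matrix.diagonal α) w) * ⟨circleDiagonal N fun k => ζ k * Circle.exp (y * ((if k = i then 1 else 0) - (if k = j then 1 else 0))), circleDiagonal_mem_archLocal_diagonal L N α w _⟩ * (q.1 : archLocal L N (Matrix.diagonal α) w)⁻¹) * q.2⁻¹ : archLocal L N (Matrix.diagonal α) w) : GL (Fin N) ℂ) : Matrix (Fin N) (Fin N) ℂ)) := by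
    intro q; funext y
    rw [hconj]
    simp only [hΨ, hc, hLr, ContinuousLinearMap.inr_apply, Prod.mk_add_mk, zero_add, add_zero, coe_conj_archLocal]
  -- joint continuity of `F`
  have hFc : Continuous F := by
    have h2 := continuous_iteratedFDeriv_comp_affine_param hΨd Lr hcc 2 (0 : ℝ)
    have hF' : F = fun q => (iteratedFDeriv ℝ 2 (fun y : ℝ => Ψ (Lr y + c q)) 0) (fun _ => 1) := by
      rw [hF]; funext q
      rw [iteratedDeriv_eq_iteratedFDeriv, hpres q]
    rw [hF']
    exact (ContinuousMultilinearMap.apply ℝ (fun _ : Fin 2 => ℝ) E (fun _ => 1)).continuous.comp h2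
  -- compact support of `F`: off `S·M⁻¹` (in `g`) the `y`-germ vanishes
  obtain ⟨δ, hδ, S, hS, hS0⟩ := exists_closedBall_isCompact_apply_conj_circleDiagonal_angles_eq_zero_of_blocks L N α w hα hreal b hsign Θ hfc ζ 0
    (fun k l hkl => by simpa only [Pi.zero_apply, Circle.exp_zero, mul_one] using hζ k l hkl)
  have hK : IsCompact ((fun p : archLocal L N (Matrix.diagonal α) w × ↥(Subgroup.centralizer ({(⟨circleDiagonal N ζ, circleDiagonal_mem_archLocal_diagonal L N α w ζ⟩ : archLocal L N (Matrix.diagonal α) w)} : Set (archLocal L N (Matrix.diagonal α) w))) => p.1 * (p.2 : archLocal L N (Matrix.diagonal α) w)⁻¹) '' (S ×ˢ Set.univ)) :=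
    (hS.prod isCompact_univ).image (continuous_fst.mul ((continuous_subtype_val.comp continuous_snd).inv))
  have hFsupp : HasCompactSupport F := by
    refine HasCompactSupport.intro (isCompact_univ.prod hK) fun q hq => ?_
    rw [hF]
    -- `q.2 ∉ S·M⁻¹` ⇒ `q.2 * q.1 ∉ S`
    have hnot : q.2 * (q.1 : archLocal L N (Matrix.diagonal α) w) ∉ S := by
      intro hmem
      exact hq ⟨Set.mem_univ _, ⟨(q.2 * (q.1 : archLocal L N (Matrix.diagonal α) w), q.1), ⟨hmem, Set.mem_univ _⟩, by simp only [mul_inv_cancel_right]⟩⟩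
    -- the `y`-germ vanishes near `0`
    have hlc : Continuous fun y : ℝ => fun k : Fin N => y * ((if k = i then (1:ℝ) else 0) - (if k = j then 1 else 0)) := hline.continuous
    have hU : (fun y : ℝ => fun k : Fin N => y * ((if k = i then (1:ℝ) else 0) - (if k = j then 1 else 0))) ⁻¹' Metric.closedBall 0 δ ∈ 𝓝 (0 : ℝ) := by
      refine hlc.continuousAt.preimage_mem_nhds ?_
      have h00 : (fun k : Fin N => (0 : ℝ) * ((if k = i then (1:ℝ) else 0) - (if k = j then 1 else 0))) = 0 := funext fun k => by
        rw [zero_mul]; rfl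
      rw [h00]
      exact Metric.closedBall_mem_nhds 0 hδ
    have hzero : (fun y : ℝ => Θ ((((q.2 * ((q.1 : archLocal L N (Matrix.diagonal α) w) * ⟨circleDiagonal N fun k => ζ k * Circle.exp (y * ((if k = i then 1 else 0) - (if k = j then 1 else 0))), circleDiagonal_mem_archLocal_diagonal L N α w _⟩ * (q.1 : archLocal L N (Matrix.diagonal α) w)⁻¹) * q.2⁻¹ : archLocal L N (Matrix.diagonal α) w) : GL (Fin N) ℂ) : Matrix (Fin N) (Fin N) ℂ))) =ᶠ[𝓝 0]
        fun _ => (0 : E) := by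
      filter_upwards [hU] with y hy
      rw [hconj]
      exact hS0 (q.2 * (q.1 : archLocal L N (Matrix.diagonal α) w)) hnot _ hy
    show iteratedDeriv 2 _ 0 = 0
    rw [hzero.iteratedDeriv_eq 2, iteratedDeriv_const]
    simp
  have hint : Integrable F (μ.prod ν) := hFc.integrable_of_hasCompactSupport hFsupp
  rw [hF] at hint
  exact integral_integral_swap hint

end Fubini

end Literature.NumberTheory.Automorphic.UnitaryGroup

end
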